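/-
Copyright (c) 2026 the pub-hodgecm-mathlib formalisation cell (harness21).  Prover seat hodgecm-mathlib-LH4-p01 (g10): road M6 → F3 «TOT-Λ BY OVER-ORDERS» (LEAD F0P3a-plan
T14-66 ∕ T15-32 «GO-LOW»), brick F5-(0) v2-W «THE θ-PACKAGE OF THE WILD UNIT ROW WITH ITS SECOND INVOLUTION» for the F3-5 ∕ F5 pen LH7-p04 (g12) («W TOO» 02:36:51Z); 2026-09-03.
-/
import Literature.NumberTheory.Rogawski1990.InertPlaceThetaPackageWildUnit        -- ★ FILE C-W p853161 (this seat): `exists_thetaPackage_wildUnitRow`; brings ★ [T2-L-W] (L2u) and ★ FILE C `exists_isUnit_moved_by_galAdicCompletionMap`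
import Literature.NumberTheory.LocalFields.UnramifiedQuadraticNormAtInertPlace    -- ★ `exists_mul_galAdicCompletionMap_eq_of_inert` (unit norms at an inert place)
import Literature.NumberTheory.Automorphic.QuadraticFixedNormSupply                -- ★ (S2) p853117: `exists_mul_map_eq_of_valuation_eq`
import Literature.NumberTheory.Automorphic.UnitaryGroupSplitPlace                  -- ★ `algEquiv_mul_self_eq_one`
import Literature.NumberTheory.Automorphic.TypeTwoCommutantBridge                  -- ★ (D3) §1 `valuation_map_eq_of_involutive`
import HarnessLib

/-!
# The θ-package of the wild unit row at an inert place, with the second involution `ι′` (`ι′α = −α`) and the gate's dictionaries `hfix` (rE) (nE), `ι′θ ≠ θ`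

Topic `NumberTheory/Rogawski1990`; namespace `Literature.NumberTheory.Rogawski1990`.  THEOREMS ONLY (no definition, no instance, no notation, no named fact, no `sorry`).
Cell `pub/hodgecm-mathlib` (D-0151), crux H413 = `stmt-HodgeConjecture-24833`; road M6 → F3, brick **F5-(0) v2-W** (twin of ★ `InertPlaceThetaPackageUniformiserInvolution`): ★ FILE C-W
`exists_thetaPackage_wildUnitRow` delivers, at an inert CM place `w ∣ v` and a place `w₁ ∣ w` of the eigen-field `M = E(δ)`, `δ² = m`, `d⁻¹m ∈ (E_w^×)²` for a `σ_w`-fixed WILD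
UNIT `d = 1 + w₀`, `|w₀| = q^{−(2k+1)} > |4|`, and a `σ_w`-fixed uniformiser `ϖ`, the letters `aF k₀ θ s̃` of ★ (c5-ii) FILE A with `θ = (α − 1)∕ι₁ϖ^k`, `α² = ι₁d`.  The F4 GATE on
this row (★ C8-unit `SymmetricEigenframe.gate_at_generator_wildUnit`) wants, for the SAME `θ s̃` and `α`, the `E_w`-linear involution `ι′` of `M_{w₁}` with `ι′α = −α` (★ [T2-L-W]
(L2u) `exists_involutions_of_wildUnit`), isometric (★ (D3) `valuation_map_eq_of_involutive`) and commuting with `s̃`, and: `hfix` (`ι′`-fixed elements are `ι₁ x` — the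
`θ`-coordinate dies because `ι′θ − θ = −2α∕ι₁ϖ^k ≠ 0`), (rE) (they have even order, `|ι₁ x| = |x|²`), (nE) (a `s̃`- and `ι′`-fixed `c` with `4 ∣ ord c` is `ι₁(t·σ_w t)`: `c = ι₁ p`,
`σ_w p = p`, `ord p = 2k′`, `p = t·σ_w t` by ★ (S2) on the INERT unit norms ★ `exists_mul_galAdicCompletionMap_eq_of_inert` with `x := ϖ^{−k′}`), and `ι′θ ≠ θ`.  Exported next to
FILE C-W's letters in ONE existential (with `α` now bound at top level), so that F5 feeds ★ F5-(0) `ncard_isSelfDualLattice_stable_eq_phiTHn_inertPlace`'s `hgateV` from ★ C8-unit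
with one `obtain` (wild unit row).
HONEST LABEL: HC_CM is proved only modulo the 2 remaining named inputs (hLiu418 24832, h413 24833) until rung 0 closes; assembly of ★ bricks, asserts nothing printed;
count-neutral (pays no organ; zero label movement until F5 ★ and a desk-priced rider).

* **`exists_thetaPackage_wildUnitRow_involution`**.

## References
* [SerreLocalFields1979] J.-P. Serre, *Local Fields*, GTM 67 (1979): Ch. I §6 Prop. 17–18 (Eisenstein basis), Ch. V §2 Prop. 3 and Cor. (unit norms, unramified case), Ch. V §3.
* [Jacobowitz1962] R. Jacobowitz, *Hermitian forms over local fields*, Amer. J. Math. 84 (1962): §5 (norm groups at ramified ∕ unramified `K ∕ K₀`, dyadic case).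
* [Rogawski1990] J. D. Rogawski, *Automorphic Representations of Unitary Groups in Three Variables*, Ann. of Math. Stud. 123 (1990): §4.9 Lemma 4.9.3 p. 56.
-/

set_option autoImplicit false

noncomputable section

open ValuativeRel NumberField IsDedekindDomain
open scoped ValuativeRel
open Literature.NumberTheory.Automorphic Literature.NumberTheory.Automorphic.UnitaryGroup Literature.NumberTheory.NumberFields

namespace Literature.NumberTheory.Rogawski1990

/-- **THE θ-PACKAGE OF THE WILD UNIT ROW WITH ITS SECOND INVOLUTION.**  ★ FILE C-W `exists_thetaPackage_wildUnitRow`'s letters for `aF k₀ θ s̃` (verbatim, same order, the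
square root `α` of `ι₁ d` now bound at top level: `α² = ι₁ d ∧ θ = (α − 1)∕ι₁ϖ^k`), followed by: the involution `ι′` (`ι′ ∘ ι₁ = ι₁`, `ι′α = −α`, `ι′ι′ = 1`, `ι′𝒪 ⊆ 𝒪`, `|ι′z| = |z|`,
`s̃ι′ = ι′s̃`); `hfix` (`ι′y = y ⇒ y = ι₁ x`); (rE); (nE); and `ι′θ ≠ θ` — the `τ`-free package letters of ★ C8-unit `gate_at_generator_wildUnit` at the place.
[cite: SerreLocalFields1979, Ch. I §6 Prop. 17–18; Ch. V §2 Prop. 3, §3] [cite: Jacobowitz1962, §5] -/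
theorem exists_thetaPackage_wildUnitRow_involution
    {F E : Type} [Field F] [NumberField F] [Field E] [NumberField E] [Algebra F E] [Algebra.IsQuadraticExtension F E]
    (c : E ≃ₐ[F] E) (v : HeightOneSpectrum (𝓞 F)) (hc : c ≠ 1) (hunr : Algebra.IsUnramifiedIn (𝓞 E) v.asIdeal)
    (w : PlacesOver E v) (hw : c • w.1 = w.1)
    {M : Type} [Field M] [NumberField M] [Algebra E M] [Algebra.IsQuadraticExtension E M] (σM : M ≃ₐ[E] M) {δ : M} (hσδ : σM δ = -δ) (hδ : δ ≠ 0)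
    {m : E} (hm : algebraMap E M m = δ ^ 2)
    {d w₀ : w.1.adicCompletion E} (hdw : d = 1 + w₀) {k : ℕ} (hw₀ : Valued.v w₀ = WithZero.exp (-(2 * (k : ℤ) + 1)))
    (h4 : Valued.v (4 : w.1.adicCompletion E) < Valued.v w₀) (hdm : IsSquare (d⁻¹ * (m : w.1.adicCompletion E)))
    {ϖ : w.1.adicCompletion E} (hϖ : Valued.v ϖ = WithZero.exp (-1 : ℤ))
    (hσd : galAdicCompletionMap (L := E) c hw d = d) (hσϖ : galAdicCompletionMap (L := E) c hw ϖ = ϖ) (w₁ : PlacesOver M w.1) :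
    ∃ (aF k₀ : v.adicCompletion F) (θ : w₁.1.adicCompletion M) (s' ι' : w₁.1.adicCompletion M →+* w₁.1.adicCompletion M) (α : w₁.1.adicCompletion M),
      -- ★ FILE C-W's letters (`α` exposed)
      (toPlace v w aF = -2 / ϖ ^ k ∧ toPlace v w k₀ = w₀ / ϖ ^ (2 * k) ∧ Valued.v aF < 1 ∧ Valued.v k₀ = WithZero.exp (-1 : ℤ) ∧
      (α ^ 2 = toPlace w.1 w₁ d ∧ θ = (α - 1) / toPlace w.1 w₁ ϖ ^ k) ∧ Valued.v θ = WithZero.exp (-1 : ℤ) ∧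
      θ ^ 2 = toPlace w.1 w₁ (toPlace v w aF) * θ + toPlace w.1 w₁ (toPlace v w k₀) ∧
      (∀ z : w₁.1.adicCompletion M, ∃! pq : w.1.adicCompletion E × w.1.adicCompletion E, z = toPlace w.1 w₁ pq.1 + toPlace w.1 w₁ pq.2 * θ) ∧
      (∀ p q : w.1.adicCompletion E, toPlace w.1 w₁ p + toPlace w.1 w₁ q * θ ∈ 𝒪[w₁.1.adicCompletion M] ↔ p ∈ 𝒪[w.1.adicCompletion E] ∧ q ∈ 𝒪[w.1.adicCompletion E]) ∧
      (∀ x, s' (toPlace w.1 w₁ x) = toPlace w.1 w₁ (galAdicCompletionMap (L := E) c hw x)) ∧ s' θ = θ ∧ (∀ z, s' (s' z) = z) ∧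
      (∀ z : 𝒪[w₁.1.adicCompletion M], s' z ∈ 𝒪[w₁.1.adicCompletion M]) ∧ (∀ z, Valued.v (s' z) = Valued.v z) ∧
      (∀ c₁ : w₁.1.adicCompletion M, c₁ ≠ 0 → s' c₁ = c₁ → Even (WithZero.log (Valued.v c₁)) → ∃ a : w₁.1.adicCompletion M, a * s' a * c₁ = 1)) ∧
      -- the second involution `ι′`
      ((∀ x, ι' (toPlace w.1 w₁ x) = toPlace w.1 w₁ x) ∧ ι' α = -α ∧ (∀ z, ι' (ι' z) = z) ∧
        (∀ z : 𝒪[w₁.1.adicCompletion M], ι' z ∈ 𝒪[w₁.1.adicCompletion M]) ∧ (∀ z, Valued.v (ι' z) = Valued.v z) ∧ (∀ z, s' (ι' z) = ι' (s' z))) ∧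
      -- `hfix`, (rE), (nE), `ι′θ ≠ θ`
      (∀ y : w₁.1.adicCompletion M, ι' y = y → ∃ x : w.1.adicCompletion E, toPlace w.1 w₁ x = y) ∧
      (∀ x : w₁.1.adicCompletion M, x ≠ 0 → ι' x = x → Even (WithZero.log (Valued.v x))) ∧
      (∀ c₁ : w₁.1.adicCompletion M, c₁ ≠ 0 → s' c₁ = c₁ → ι' c₁ = c₁ → (4 : ℤ) ∣ WithZero.log (Valued.v c₁) →
        ∃ a : w₁.1.adicCompletion M, ι' a = a ∧ a * s' a * c₁ = 1) ∧
      ι' θ ≠ θ := by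
  -- ### ★ FILE C-W
  obtain ⟨aF, k₀, θ, s', haFι, hk₀ι, haF, hk₀, ⟨α, hα, hθα⟩, hθv, hθ, hcoord, hint, hs'ι, hs'θ, hs's', hs'O, hs'v, hnorm1⟩ :=
    exists_thetaPackage_wildUnitRow c v hc hunr w hw σM hσδ hδ hm hdw hw₀ h4 hdm hϖ hσd hσϖ w₁
  -- the base involution `σ_w`, `e(w₁ ∣ w) = 2`
  have hss : ∀ x, galAdicCompletionMap (L := E) c hw (galAdicCompletionMap (L := E) c hw x) = x :=
    galAdicCompletionMap_galAdicCompletionMap_of_smul_eq c w hc hw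
  have hsO : ∀ x : 𝒪[w.1.adicCompletion E], galAdicCompletionMap (L := E) c hw x ∈ 𝒪[w.1.adicCompletion E] :=
    fun x => mem_integer_galAdicCompletionMap c v w hw x
  have he : (w.1).asIdeal.ramificationIdx' w₁.1.asIdeal = 2 := (ramifiedPlace_currency_of_wildUnit M w.1 σM hσδ hδ hm hdw hw₀ h4 hdm w₁).2.2
  have hjv : ∀ p : w.1.adicCompletion E, Valued.v (toPlace w.1 w₁ p) = Valued.v p ^ 2 := valued_toPlace_of_ramificationIdx'_eq_two M w.1 w₁ he
  have hϖ0 : ϖ ≠ 0 := fun h0 => by rw [h0, map_zero] at hϖ; exact WithZero.coe_ne_zero hϖ.symm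
  have hπk : toPlace w.1 w₁ ϖ ^ k ≠ 0 := pow_ne_zero _ ((_root_.map_ne_zero _).2 hϖ0)
  haveI : CharZero (w₁.1.adicCompletion M) := charZero_of_injective_algebraMap (algebraMap M (w₁.1.adicCompletion M)).injective
  have hα0 : α ≠ 0 := fun h0 => by
    have h : toPlace w.1 w₁ d = 0 := by rw [← hα, h0]; ring
    rw [_root_.map_eq_zero] at h
    have hdv : Valued.v d = 1 := by
      rw [hdw]; refine Valuation.map_one_add_of_lt _ ?_
      rw [hw₀, ← WithZero.exp_zero]; exact WithZero.exp_lt_exp.2 (by omega)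
    rw [h, map_zero] at hdv; exact zero_ne_one hdv
  -- ### ★ [T2-L-W] (L2u): the involution `ι′` over the SAME `α`
  obtain ⟨-, ι', hι'j, hι'α, hι'ι', hι'O⟩ :=
    exists_involutions_of_wildUnit M w.1 σM hσδ hδ hm hdw hw₀ h4 hdm hϖ w₁ (galAdicCompletionMap (L := E) c hw) hss hσd hσϖ hsO hα
  have hι'val : ∀ z, valuation (w₁.1.adicCompletion M) (ι' z) = valuation (w₁.1.adicCompletion M) z :=
    Literature.NumberTheory.Automorphic.valuation_map_eq_of_involutive ι' hι'ι' hι'O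
  have hι'v : ∀ z, Valued.v (ι' z) = Valued.v z := fun z => (v_eq_iff_valuation_eq _ _).2 (hι'val z)
  -- `ι′θ`, `s̃α`, the commutation
  have hι'θ : ι' θ = (-α - 1) / toPlace w.1 w₁ ϖ ^ k := by rw [hθα, map_div₀, map_sub, hι'α, map_one, map_pow, hι'j]
  have hs'α : s' α = α := by
    have hαθ : α = θ * toPlace w.1 w₁ ϖ ^ k + 1 := by rw [hθα, div_mul_cancel₀ _ hπk, sub_add_cancel]
    rw [hαθ, map_add, map_mul, map_pow, hs'θ, hs'ι, hσϖ, map_one]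
  have hs'ι'θ : s' (ι' θ) = ι' θ := by rw [hι'θ, map_div₀, map_sub, map_neg, hs'α, map_one, map_pow, hs'ι, hσϖ]
  have hco : ∀ z : w₁.1.adicCompletion M, ∃ pq : w.1.adicCompletion E × w.1.adicCompletion E, z = toPlace w.1 w₁ pq.1 + toPlace w.1 w₁ pq.2 * θ :=
    fun z => (hcoord z).exists
  have hcomm : ∀ z, s' (ι' z) = ι' (s' z) := fun z => by
    obtain ⟨pq, rfl⟩ := hco z
    rw [map_add, map_mul, hι'j, hι'j, map_add, map_mul, hs'ι, hs'ι, hs'ι'θ, map_add, map_mul, hs'ι, hs'ι, hs'θ, map_add, map_mul, hι'j, hι'j]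
  -- `ι′θ ≠ θ` and `hfix`
  have hι'θne : ι' θ ≠ θ := by
    intro h
    rw [hι'θ, hθα, div_left_inj' hπk] at h
    have h2 : (2 : w₁.1.adicCompletion M) * α = 0 := by linear_combination -h
    exact (mul_ne_zero two_ne_zero hα0) h2
  have hfix : ∀ y : w₁.1.adicCompletion M, ι' y = y → ∃ x : w.1.adicCompletion E, toPlace w.1 w₁ x = y := by
    intro y hy
    obtain ⟨⟨p, q⟩, rfl⟩ := hco y
    have h : toPlace w.1 w₁ q * (ι' θ - θ) = 0 := by
      have h' := hy; rw [map_add, map_mul, hι'j, hι'j] at h'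
      linear_combination h'
    rcases mul_eq_zero.1 h with hq | hθθ
    · exact ⟨p, by rw [hq, zero_mul, add_zero]⟩
    · exact absurd (sub_eq_zero.1 hθθ) hι'θne
  -- (rE)
  have hrE : ∀ x : w₁.1.adicCompletion M, x ≠ 0 → ι' x = x → Even (WithZero.log (Valued.v x)) := by
    intro x hx0 hιx
    obtain ⟨p, rfl⟩ := hfix x hιx
    have hp0 : Valued.v p ≠ 0 := (Valuation.ne_zero_iff _).2 fun h => hx0 (by rw [h, map_zero])
    rw [hjv, ← WithZero.exp_log hp0, ← WithZero.exp_nsmul, WithZero.log_exp, two_nsmul]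
    exact ⟨_, rfl⟩
  -- unit norms at the INERT place, field level
  have hcc : c * c = 1 := algEquiv_mul_self_eq_one (F := F) hc
  have hunitE : ∀ x : 𝒪[w.1.adicCompletion E], IsUnit x ↔ Valued.v (x : w.1.adicCompletion E) = 1 := fun x => by
    rw [(Valuation.integer.integers (valuation (w.1.adicCompletion E))).isUnit_iff_valuation_eq_one, v_eq_one_iff_valuation_eq_one]; rfl
  have hnormU : ∀ u : w.1.adicCompletion E, Valued.v u = 1 → galAdicCompletionMap (L := E) c hw u = u →
      ∃ t : w.1.adicCompletion E, t * galAdicCompletionMap (L := E) c hw t = u := by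
    intro u hu1 hsu
    have huO : u ∈ 𝒪[w.1.adicCompletion E] := (v_le_one_iff_mem_integer u).1 hu1.le
    obtain ⟨t, ht⟩ := LocalFields.UnramifiedQuadraticNorm.exists_mul_galAdicCompletionMap_eq_of_inert c v hc hcc hunr w hw ⟨u, huO⟩ ((hunitE _).2 hu1) hsu
    exact ⟨t, ht⟩
  -- (nE)
  have hnE : ∀ c₁ : w₁.1.adicCompletion M, c₁ ≠ 0 → s' c₁ = c₁ → ι' c₁ = c₁ → (4 : ℤ) ∣ WithZero.log (Valued.v c₁) →
      ∃ a : w₁.1.adicCompletion M, ι' a = a ∧ a * s' a * c₁ = 1 := by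
    intro c₁ hc0 hsc hιc h4'
    obtain ⟨p, rfl⟩ := hfix c₁ hιc
    have hp0 : p ≠ 0 := fun h => hc0 (by rw [h, map_zero])
    have hvp0 : Valued.v p ≠ 0 := (Valuation.ne_zero_iff _).2 hp0
    have hsp : galAdicCompletionMap (L := E) c hw p = p := (toPlace w.1 w₁).injective (by rw [← hs'ι, hsc])
    rw [hjv, ← WithZero.exp_log hvp0, ← WithZero.exp_nsmul, WithZero.log_exp] at h4'
    obtain ⟨k', hk'⟩ : (2 : ℤ) ∣ WithZero.log (Valued.v p) := by
      obtain ⟨j, hj⟩ := h4'; exact ⟨j, by simp only [nsmul_eq_mul, Nat.cast_ofNat] at hj; omega⟩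
    obtain ⟨t, ht⟩ := Literature.NumberTheory.Automorphic.exists_mul_map_eq_of_valuation_eq Valued.v (galAdicCompletionMap (L := E) c hw) hss hnormU
      (ϖ ^ (-k')) p hp0 hsp (by
        have hx : ϖ ^ (-k') * galAdicCompletionMap (L := E) c hw (ϖ ^ (-k')) = (ϖ * ϖ) ^ (-k') := by rw [map_zpow₀, hσϖ, mul_zpow]
        rw [hx, map_zpow₀, map_mul, hϖ, ← WithZero.exp_add, ← WithZero.exp_zsmul, ← WithZero.exp_log hvp0, hk', WithZero.exp_inj, smul_eq_mul]
        ring)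
    refine ⟨(toPlace w.1 w₁ t)⁻¹, by rw [map_inv₀, hι'j], ?_⟩
    rw [map_inv₀, hs'ι, ← mul_inv, ← map_mul, ht]
    exact inv_mul_cancel₀ (by rw [_root_.map_ne_zero]; exact hp0)
  exact ⟨aF, k₀, θ, s', ι', α, ⟨haFι, hk₀ι, haF, hk₀, ⟨hα, hθα⟩, hθv, hθ, hcoord, hint, hs'ι, hs'θ, hs's', hs'O, hs'v, hnorm1⟩,
    ⟨hι'j, hι'α, hι'ι', hι'O, hι'v, hcomm⟩, hfix, hrE, hnE, hι'θne⟩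

end Literature.NumberTheory.Rogawski1990
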